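import Summits.AtomisticToContinuum.FouriersLaw.Theses.ContactStieltjesMeasure

/-!
# `ContactUpperDensity` (stmt-AtomisticToContinuum-15249): the exact residual of `closes` is
# FRICTION-SUBLINEAR RESPONSE — checked scratch (planner, crux-ideate k2 g12)

Nothing here is proposed to the tree.

`closes` of route `ContactStieltjesMeasure` uses (U) `ContactUpperDensity` only to dominate
`N Φ_N(t) w_γ(t)`, `w_γ(t) = 2t/(γ²+t²)²`, on `(0,∞)`.  Given (M) `ContactMeasureLimit`, local
domination on every `(0,S]` is free (monotonicity of `Φ_N`), so the only thing (U) supplies is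
TIGHTNESS AT INFINITY of `N Φ_N w_γ dt`.  That tightness is equivalent (this file, `closes_fsr`) to

  (FSR) `FrictionSublinearResponse`: for every `ε > 0` there is ONE friction `γ ≥ 1` and an `N₀`
  with `D_N(γ) ≤ ε·γ` for all `N ≥ N₀` —

i.e. `liminf_{γ→∞} (limsup_{N→∞} D_N(γ)) / γ = 0`: the fixed-friction upper conductivity grows
sublinearly in the bath friction (physically `D_N(γ) → κ` for every `γ`, so FSR holds with
`γ = 2κ/ε`).  The order of limits is `N → ∞` FIRST at fixed `γ`: there is no friction window
`γ ∈ [1,N]` in FSR, and `N₀` may depend on `γ`.  FSR is implied by (U) (layer cake: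
`D_N(γ) ≤ C(1+π/2)` for `γ ≥ 1`), by (U_w) of `Recut.lean`, and by `TailTightness` of
IDEATION-CENSUS-k1g8 §N-a; it is NOT implied by `FouriersLaw` (whose `κ` may depend on `γ`).

Main results (all sorry-free):
* `closes_fsr : StieltjesRepresentation → FrictionSublinearResponse → ContactMeasureLimit →
  ConductanceLowerBound → FouriersLaw` — the re-glued deciding theorem;
* `fsr_of_upperDensity : StieltjesRepresentation → ContactUpperDensity → FrictionSublinearResponse`
  — the re-glue WEAKENS the route's hypotheses;
* `tendsto_integral_of_tight` — the abstract Vitali-type lemma (monotone integrands + tail tightness,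
  local domination for free).
Placement (see `FSR-NOTE-k2g12.md`): FSR at the produced friction `γ₀` is an `N`-uniform upper bound
on the finite-size conductivity `D_N(γ₀)` with constant `o(γ₀)` — the shared waypoint
`BoundedResponse` (stmt-AtomisticToContinuum-11071, = `HasBoundedResponse (pinnedChain …)`) at one
friction and one temperature; barrier `FixedLengthNoConductivityControl` applies to it verbatim.
-/

namespace Summit.AtomisticToContinuum.FouriersLaw.Cruxes.ContactUpperDensity.Fsr

open MeasureTheory Set Filter Topology
open Summit.AtomisticToContinuum.FouriersLaw.Theses.ContactStieltjesMeasure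
open Literature.MathematicalPhysics.KineticTheory.HeatConduction

/-- (FSR) FRICTION-SUBLINEAR RESPONSE, in the conductance currency of `ConductanceLowerBound` /
`BoundedResponse`: for `pinnedChain ω₂ lam β` (all `> 0`) and `T > 0`, for every `ε > 0` there is a
friction `γ ≥ 1` such that — under weak-NESS uniqueness at `γ`, for every steady-state family and
every response sequence `D_N = lim_{δ→0} J_N(T+δ/2,T−δ/2)/δ` — eventually in `N`, `D_N ≤ ε·γ`. -/
def FrictionSublinearResponse : Prop :=
  ∀ ω₂ lam β : ℝ, 0 < ω₂ → 0 < lam → 0 < β → ∀ T : ℝ, 0 < T → ∀ ε : ℝ, 0 < ε →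
    ∃ γ : ℝ, 1 ≤ γ ∧
      ((∀ (N : ℕ) (T_L T_R : ℝ), 0 < T_L → 0 < T_R →
          ∀ μ ν : MeasureTheory.Measure (PhaseSpace N),
            (pinnedChain ω₂ lam β γ).IsSteadyState N T_L T_R μ →
            (pinnedChain ω₂ lam β γ).IsSteadyState N T_L T_R ν → μ = ν) →
        ∀ μ : (N : ℕ) → ℝ → ℝ → MeasureTheory.Measure (PhaseSpace N),
          (∀ (N : ℕ) (T_L T_R : ℝ), 0 < T_L → 0 < T_R →
              (pinnedChain ω₂ lam β γ).IsSteadyState N T_L T_R (μ N T_L T_R)) →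
          ∀ D : ℕ → ℝ,
            (∀ N : ℕ, Filter.Tendsto (fun δ : ℝ =>
                (pinnedChain ω₂ lam β γ).totalCurrent (μ N (T + δ / 2) (T - δ / 2)) / δ)
                (nhdsWithin 0 {(0 : ℝ)}ᶜ) (nhds (D N))) →
            ∃ N₀ : ℕ, ∀ N : ℕ, N₀ ≤ N → D N ≤ ε * γ)

/-! ### The kernel `w_γ(t) = 2t/(γ²+t²)²` -/

theorem w_pos (γ t : ℝ) (hγ : 0 < γ) (ht : 0 < t) : 0 < 2 * t / (γ ^ 2 + t ^ 2) ^ 2 := by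
  positivity

theorem w_nonneg (γ t : ℝ) (ht : 0 ≤ t) : 0 ≤ 2 * t / (γ ^ 2 + t ^ 2) ^ 2 := by
  positivity

/-- `w_γ(t) ≤ ((γ²+1)/γ³)·(1+t²)⁻¹` for `t ≥ 0` (from `2γt ≤ γ²+t²`). -/
theorem w_le_inv_one_add_sq (γ : ℝ) (hγ : 0 < γ) (t : ℝ) (ht : 0 ≤ t) :
    2 * t / (γ ^ 2 + t ^ 2) ^ 2 ≤ (γ ^ 2 + 1) / γ ^ 3 * (1 + t ^ 2)⁻¹ := by
  have hγ3 : 0 < γ ^ 3 := by positivity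
  have hden : 0 < (γ ^ 2 + t ^ 2) ^ 2 := by positivity
  have h1t : 0 < 1 + t ^ 2 := by positivity
  rw [← div_eq_mul_inv, div_div, div_le_div_iff₀ hden (by positivity)]
  -- 2 t (γ³ (1+t²)) ≤ (γ²+1) (γ²+t²)²
  have hamgm : 2 * γ * t ≤ γ ^ 2 + t ^ 2 := by nlinarith [sq_nonneg (γ - t)]
  have hA : (γ ^ 2 + t ^ 2) * (2 * γ * t) ≤ (γ ^ 2 + t ^ 2) ^ 2 := by
    nlinarith [mul_le_mul_of_nonneg_left hamgm (by positivity : (0:ℝ) ≤ γ ^ 2 + t ^ 2)]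
  nlinarith [hA, mul_nonneg (mul_nonneg hγ.le ht) (sq_nonneg γ), mul_nonneg hγ.le ht,
    mul_nonneg (mul_nonneg hγ.le ht) (sq_nonneg t), sq_nonneg γ, sq_nonneg t,
    mul_nonneg (sq_nonneg γ) (sq_nonneg t)]

theorem w_continuous (γ : ℝ) (hγ : 0 < γ) : Continuous fun t : ℝ => 2 * t / (γ ^ 2 + t ^ 2) ^ 2 := by
  refine Continuous.div (by fun_prop) (by fun_prop) fun t => ?_
  positivity

theorem w_integrableOn (γ : ℝ) (hγ : 0 < γ) :
    IntegrableOn (fun t : ℝ => 2 * t / (γ ^ 2 + t ^ 2) ^ 2) (Ioi 0) := by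
  have hint : IntegrableOn (fun t : ℝ => (γ ^ 2 + 1) / γ ^ 3 * (1 + t ^ 2)⁻¹) (Ioi 0) :=
    (integrable_inv_one_add_sq.const_mul _).integrableOn
  refine MeasureTheory.Integrable.mono' hint (w_continuous γ hγ).measurable.aestronglyMeasurable ?_
  refine (ae_restrict_iff' measurableSet_Ioi).2 (Eventually.of_forall fun t ht => ?_)
  have ht' : 0 < t := ht
  rw [Real.norm_eq_abs, abs_of_nonneg (w_nonneg γ t ht'.le)]
  exact w_le_inv_one_add_sq γ hγ t ht'.le

/-- Tail comparison: for `t ≥ γ₀ > 0` and any `γ > 0`, `w_γ(t) ≤ 4·w_{γ₀}(t)`. -/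
theorem w_tail_le (γ γ₀ t : ℝ) (hγ : 0 < γ) (hγ₀ : 0 < γ₀) (ht : γ₀ ≤ t) :
    2 * t / (γ ^ 2 + t ^ 2) ^ 2 ≤ 4 * (2 * t / (γ₀ ^ 2 + t ^ 2) ^ 2) := by
  have ht0 : 0 < t := lt_of_lt_of_le hγ₀ ht
  have hA : 0 < (γ ^ 2 + t ^ 2) ^ 2 := by positivity
  have hB : 0 < (γ₀ ^ 2 + t ^ 2) ^ 2 := by positivity
  have hsq : γ₀ ^ 2 ≤ t ^ 2 := by nlinarith
  have hBA : (γ₀ ^ 2 + t ^ 2) ^ 2 ≤ 4 * (γ ^ 2 + t ^ 2) ^ 2 := by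
    nlinarith [sq_nonneg γ, sq_nonneg t, mul_nonneg (sq_nonneg γ) (sq_nonneg t),
      mul_nonneg (sq_nonneg γ) (sq_nonneg γ)]
  have e : 4 * (2 * t / (γ₀ ^ 2 + t ^ 2) ^ 2) = 8 * t / (γ₀ ^ 2 + t ^ 2) ^ 2 := by ring
  rw [e, div_le_div_iff₀ hA hB]
  nlinarith [hBA, ht0]

/-- `c · Φ · w_γ` is integrable on `(0,∞)` for a bounded monotone `Φ` vanishing on `(−∞,0]`. -/
theorem mul_w_integrableOn (Φ : ℝ → ℝ) (hmono : Monotone Φ) (h0 : ∀ s : ℝ, s ≤ 0 → Φ s = 0)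
    (m : ℝ) (hm : ∀ s, Φ s ≤ m) (c γ : ℝ) (hγ : 0 < γ) :
    IntegrableOn (fun t : ℝ => c * Φ t * (2 * t / (γ ^ 2 + t ^ 2) ^ 2)) (Ioi 0) := by
  have hΦnn : ∀ t, 0 ≤ t → 0 ≤ Φ t := fun t ht => by simpa [h0 0 le_rfl] using hmono ht
  have hm0 : 0 ≤ m := le_trans (by simp [h0 0 le_rfl]) (hm 0)
  have hint : IntegrableOn (fun t : ℝ => |c| * m * (2 * t / (γ ^ 2 + t ^ 2) ^ 2)) (Ioi 0) :=
    (w_integrableOn γ hγ).const_mul _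
  refine MeasureTheory.Integrable.mono' hint ?_ ?_
  · exact ((measurable_const.mul hmono.measurable).mul
      (w_continuous γ hγ).measurable).aestronglyMeasurable
  · refine (ae_restrict_iff' measurableSet_Ioi).2 (Eventually.of_forall fun t ht => ?_)
    have ht' : 0 < t := ht
    have hw := w_nonneg γ t ht'.le
    rw [Real.norm_eq_abs, abs_mul, abs_mul, abs_of_nonneg (hΦnn t ht'.le), abs_of_nonneg hw]
    exact mul_le_mul_of_nonneg_right (mul_le_mul_of_nonneg_left (hm t) (abs_nonneg c)) hw

/-! ### Vitali-type convergence on `(0,∞)` from tail tightness -/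

/-- Convergence of `∫_{(0,∞)} f_N w` to `∫_{(0,∞)} M w` for eventually monotone nonnegative
`f_N → M` a.e., a continuous positive integrable weight `w`, and TAIL TIGHTNESS
`∀ ε > 0, ∃ S > 0, ∀ᶠ N, ∫_{(S,∞)} f_N w ≤ ε`.  Local domination on `(0,S]` comes for free from
monotonicity + tightness; no global majorant is assumed. -/
theorem tendsto_integral_of_tight (f : ℕ → ℝ → ℝ) (M w : ℝ → ℝ)
    (hw_cont : Continuous w) (hw_pos : ∀ t, 0 < t → 0 < w t) (hw_int : IntegrableOn w (Ioi 0))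
    (hf : ∀ᶠ N in atTop, Measurable (f N) ∧ (∀ t, 0 ≤ t → 0 ≤ f N t) ∧ Monotone (f N))
    (hf_int : ∀ᶠ N in atTop, IntegrableOn (fun t => f N t * w t) (Ioi 0))
    (hM_meas : Measurable M)
    (hlim : ∀ᵐ t ∂(volume.restrict (Ioi (0 : ℝ))), Tendsto (fun N => f N t) atTop (𝓝 (M t)))
    (htail : ∀ ε : ℝ, 0 < ε → ∃ S : ℝ, 0 < S ∧ ∀ᶠ N in atTop, ∫ t in Ioi S, f N t * w t ≤ ε) :
    IntegrableOn (fun t => M t * w t) (Ioi 0) ∧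
      Tendsto (fun N => ∫ t in Ioi 0, f N t * w t) atTop (𝓝 (∫ t in Ioi 0, M t * w t)) := by
  -- (1) local bound from tightness + monotonicity
  obtain ⟨S₁, hS₁, ht₁⟩ := htail 1 one_pos
  have hloc : ∀ S : ℝ, 0 < S → ∃ B : ℝ, 0 ≤ B ∧ ∀ᶠ N in atTop, ∀ t, 0 < t → t ≤ S → f N t ≤ B := by
    intro S hS
    set S' : ℝ := max S S₁ with hS'
    have hS'pos : 0 < S' := lt_of_lt_of_le hS (le_max_left _ _)
    obtain ⟨x, hx, hxmin⟩ := (isCompact_Icc (a := S') (b := S' + 1)).exists_isMinOn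
      (nonempty_Icc.2 (by linarith)) hw_cont.continuousOn
    have hxpos : 0 < x := lt_of_lt_of_le hS'pos hx.1
    have hwx : 0 < w x := hw_pos x hxpos
    refine ⟨1 / w x, by positivity, ?_⟩
    filter_upwards [ht₁, hf, hf_int] with N htN hfN hiN
    intro t ht htS
    have hmono := hfN.2.2
    have h1 : f N t ≤ f N S' := hmono (le_trans htS (le_max_left _ _))
    -- f N S' * w x ≤ ∫_{Ioc S' (S'+1)} f N * w ≤ ∫_{Ioi S₁} f N * w ≤ 1
    have hsub : Ioc S' (S' + 1) ⊆ Ioi S₁ := fun u hu =>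
      lt_of_le_of_lt (le_max_right S S₁) hu.1
    have hiN' : IntegrableOn (fun t => f N t * w t) (Ioc S' (S' + 1)) :=
      hiN.mono_set (subset_trans hsub (Ioi_subset_Ioi hS₁.le))
    have h2 : ∫ u in Ioc S' (S' + 1), f N S' * w x ≤ ∫ u in Ioc S' (S' + 1), f N u * w u := by
      refine setIntegral_mono_on (integrableOn_const (by simp)) hiN' measurableSet_Ioc ?_
      intro u hu
      have hu1 : f N S' ≤ f N u := hmono hu.1.le
      have hu2 : w x ≤ w u := hxmin ⟨hu.1.le, hu.2⟩
      have hfu : 0 ≤ f N S' := hfN.2.1 S' hS'pos.le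
      exact mul_le_mul hu1 hu2 hwx.le (le_trans hfu hu1)
    have h3 : ∫ u in Ioc S' (S' + 1), f N u * w u ≤ ∫ u in Ioi S₁, f N u * w u := by
      refine setIntegral_mono_set (hiN.mono_set (Ioi_subset_Ioi hS₁.le)) ?_ hsub.eventuallyLE
      refine (ae_restrict_iff' measurableSet_Ioi).2 (Eventually.of_forall fun u hu => ?_)
      have hu0 : 0 < u := lt_trans hS₁ hu
      exact mul_nonneg (hfN.2.1 u hu0.le) (hw_pos u hu0).le
    have hconst : ∫ u in Ioc S' (S' + 1), f N S' * w x = f N S' * w x := by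
      rw [setIntegral_const, Real.volume_real_Ioc_of_le (by linarith), smul_eq_mul]
      ring
    have h4 : f N S' * w x ≤ 1 := by linarith [hconst, h2, h3, htN]
    calc f N t ≤ f N S' := h1
      _ ≤ 1 / w x := by rw [le_div_iff₀ hwx]; exact h4
  -- (2) dominated convergence on every (0,S]
  have hDCT : ∀ S : ℝ, 0 < S → Tendsto (fun N => ∫ t in Ioc 0 S, f N t * w t) atTop
      (𝓝 (∫ t in Ioc 0 S, M t * w t)) := by
    intro S hS
    obtain ⟨B, hB0, hB⟩ := hloc S hS
    refine tendsto_integral_filter_of_dominated_convergence (fun t => B * w t) ?_ ?_ ?_ ?_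
    · filter_upwards [hf] with N hfN
      exact (hfN.1.mul hw_cont.measurable).aestronglyMeasurable
    · filter_upwards [hB, hf] with N hBN hfN
      refine (ae_restrict_iff' measurableSet_Ioc).2 (Eventually.of_forall fun t ht => ?_)
      rw [Real.norm_eq_abs, abs_of_nonneg (mul_nonneg (hfN.2.1 t ht.1.le) (hw_pos t ht.1).le)]
      exact mul_le_mul_of_nonneg_right (hBN t ht.1 ht.2) (hw_pos t ht.1).le
    · exact (hw_int.mono_set Set.Ioc_subset_Ioi_self).const_mul B
    · have hsub0 : Ioc (0:ℝ) S ⊆ Ioi 0 := Set.Ioc_subset_Ioi_self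
      have h := ae_restrict_of_ae_restrict_of_subset hsub0 hlim
      filter_upwards [h] with t ht
      exact ht.mul_const _
  -- (3) uniform bound on the full integrals
  obtain ⟨B₁, hB₁0, hB₁⟩ := hloc S₁ hS₁
  set U : ℝ := B₁ * (∫ t in Ioc 0 S₁, w t) + 1 with hU
  have hsplit : ∀ S : ℝ, 0 < S → ∀ N, IntegrableOn (fun t => f N t * w t) (Ioi 0) →
      ∫ t in Ioi 0, f N t * w t = (∫ t in Ioc 0 S, f N t * w t) + ∫ t in Ioi S, f N t * w t := by
    intro S hS N hiN
    rw [← setIntegral_union Ioc_disjoint_Ioi_same measurableSet_Ioi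
      (hiN.mono_set Set.Ioc_subset_Ioi_self) (hiN.mono_set (Ioi_subset_Ioi hS.le)),
      Ioc_union_Ioi_eq_Ioi hS.le]
  have hIU : ∀ᶠ N in atTop, ∫ t in Ioi 0, f N t * w t ≤ U := by
    filter_upwards [hB₁, ht₁, hf, hf_int] with N hBN htN hfN hiN
    have h1 : ∫ t in Ioc 0 S₁, f N t * w t ≤ ∫ t in Ioc 0 S₁, B₁ * w t := by
      refine setIntegral_mono_on (hiN.mono_set Set.Ioc_subset_Ioi_self)
        ((hw_int.mono_set Set.Ioc_subset_Ioi_self).const_mul B₁) measurableSet_Ioc ?_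
      intro t ht
      exact mul_le_mul_of_nonneg_right (hBN t ht.1 ht.2) (hw_pos t ht.1).le
    have h2 : ∫ t in Ioc 0 S₁, B₁ * w t = B₁ * ∫ t in Ioc 0 S₁, w t := integral_const_mul _ _
    rw [hsplit S₁ hS₁ N hiN]
    linarith [h1, h2, htN]
  -- (4) the limit `M w` is integrable on (0,∞)
  have hg_meas : AEStronglyMeasurable (fun t => M t * w t) (volume.restrict (Ioi (0:ℝ))) :=
    (hM_meas.mul hw_cont.measurable).aestronglyMeasurable
  have hM_bounds : ∀ S : ℝ, 0 < S → ∃ B : ℝ, 0 ≤ B ∧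
      ∀ᵐ t ∂(volume.restrict (Ioc (0:ℝ) S)), 0 ≤ M t ∧ M t ≤ B := by
    intro S hS
    obtain ⟨B, hB0, hB⟩ := hloc S hS
    refine ⟨B, hB0, ?_⟩
    have hsub0 : Ioc (0:ℝ) S ⊆ Ioi 0 := Set.Ioc_subset_Ioi_self
    have h := ae_restrict_of_ae_restrict_of_subset hsub0 hlim
    filter_upwards [h, ae_restrict_mem measurableSet_Ioc] with t ht htmem
    constructor
    · refine ge_of_tendsto ht ?_
      filter_upwards [hf] with N hfN
      exact hfN.2.1 t htmem.1.le
    · refine le_of_tendsto ht ?_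
      filter_upwards [hB] with N hBN
      exact hBN t htmem.1 htmem.2
  have hg_nn : 0 ≤ᵐ[volume.restrict (Ioi (0:ℝ))] fun t => M t * w t := by
    filter_upwards [hlim, ae_restrict_mem measurableSet_Ioi] with t ht htmem
    have htpos : 0 < t := htmem
    have hM0 : 0 ≤ M t := by
      refine ge_of_tendsto ht ?_
      filter_upwards [hf] with N hfN
      exact hfN.2.1 t htpos.le
    exact mul_nonneg hM0 (hw_pos t htpos).le
  have hgS : ∀ S : ℝ, 0 < S → IntegrableOn (fun t => M t * w t) (Ioc 0 S) := by
    intro S hS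
    obtain ⟨B, hB0, hB⟩ := hM_bounds S hS
    refine MeasureTheory.Integrable.mono' ((hw_int.mono_set Set.Ioc_subset_Ioi_self).const_mul B)
      (hM_meas.mul hw_cont.measurable).aestronglyMeasurable ?_
    filter_upwards [hB, ae_restrict_mem measurableSet_Ioc] with t ht htmem
    rw [Real.norm_eq_abs, abs_of_nonneg (mul_nonneg ht.1 (hw_pos t htmem.1).le)]
    exact mul_le_mul_of_nonneg_right ht.2 (hw_pos t htmem.1).le
  have hgS_le : ∀ S : ℝ, 0 < S → ∫ t in Ioc 0 S, M t * w t ≤ U := by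
    intro S hS
    refine le_of_tendsto (hDCT S hS) ?_
    filter_upwards [hIU, hf, hf_int] with N hN hfN hiN
    refine le_trans ?_ hN
    refine setIntegral_mono_set hiN ?_ (Set.Ioc_subset_Ioi_self.eventuallyLE)
    refine (ae_restrict_iff' measurableSet_Ioi).2 (Eventually.of_forall fun u hu => ?_)
    have hu0 : 0 < u := hu
    exact mul_nonneg (hfN.2.1 u hu0.le) (hw_pos u hu0).le
  have hg_int : IntegrableOn (fun t => M t * w t) (Ioi 0) := by
    refine integrableOn_Ioi_of_intervalIntegral_norm_bounded (l := atTop) U 0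
      (b := fun k : ℕ => (k : ℝ) + 1) (fun k => hgS _ (by positivity)) ?_ ?_
    · exact tendsto_natCast_atTop_atTop.atTop_add tendsto_const_nhds
    · refine Eventually.of_forall fun k => ?_
      have hk : (0:ℝ) ≤ (k : ℝ) + 1 := by positivity
      rw [intervalIntegral.integral_of_le hk]
      have hk' : (0:ℝ) < (k:ℝ) + 1 := by positivity
      obtain ⟨B, hB0, hB⟩ := hM_bounds _ hk'
      have e : ∫ x in Ioc 0 ((k:ℝ) + 1), ‖M x * w x‖ = ∫ x in Ioc 0 ((k:ℝ) + 1), M x * w x := by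
        refine integral_congr_ae ?_
        filter_upwards [hB, ae_restrict_mem measurableSet_Ioc] with t ht htmem
        rw [Real.norm_eq_abs, abs_of_nonneg (mul_nonneg ht.1 (hw_pos t htmem.1).le)]
      rw [e]
      exact hgS_le _ hk'
  refine ⟨hg_int, ?_⟩
  -- (5) truncations of the limit converge to the full integral
  set L : ℝ := ∫ t in Ioi 0, M t * w t with hL
  have hLS : Tendsto (fun S : ℝ => ∫ t in Ioc 0 S, M t * w t) atTop (𝓝 L) := by
    have h := intervalIntegral_tendsto_integral_Ioi (μ := volume) 0 hg_int tendsto_id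
    refine h.congr' ?_
    filter_upwards [eventually_ge_atTop (0:ℝ)] with S hS
    exact intervalIntegral.integral_of_le hS
  have hLS_le : ∀ S : ℝ, 0 < S → ∫ t in Ioc 0 S, M t * w t ≤ L := fun S hS =>
    setIntegral_mono_set hg_int hg_nn (Set.Ioc_subset_Ioi_self.eventuallyLE)
  -- (6) squeeze
  refine tendsto_order.2 ⟨fun a ha => ?_, fun b hb => ?_⟩
  · -- lower: a < L
    have hε : 0 < (L - a) / 2 := by linarith
    have hev : ∀ᶠ S in atTop, L - (L - a) / 2 < ∫ t in Ioc 0 S, M t * w t :=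
      (tendsto_order.1 hLS).1 _ (by linarith)
    obtain ⟨S, hSg, hS0⟩ := (hev.and (eventually_gt_atTop 0)).exists
    have hloc' := (tendsto_order.1 (hDCT S hS0)).1 _ (show (∫ t in Ioc 0 S, M t * w t) - (L - a) / 2 <
      ∫ t in Ioc 0 S, M t * w t by linarith)
    filter_upwards [hloc', hf, hf_int] with N hN hfN hiN
    have hmono : ∫ t in Ioc 0 S, f N t * w t ≤ ∫ t in Ioi 0, f N t * w t := by
      refine setIntegral_mono_set hiN ?_ (Set.Ioc_subset_Ioi_self.eventuallyLE)
      refine (ae_restrict_iff' measurableSet_Ioi).2 (Eventually.of_forall fun u hu => ?_)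
      have hu0 : 0 < u := hu
      exact mul_nonneg (hfN.2.1 u hu0.le) (hw_pos u hu0).le
    linarith
  · -- upper: L < b
    have hε : 0 < (b - L) / 3 := by linarith
    obtain ⟨S, hS0, htS⟩ := htail _ hε
    have hloc' := (tendsto_order.1 (hDCT S hS0)).2 _ (show ∫ t in Ioc 0 S, M t * w t <
      (∫ t in Ioc 0 S, M t * w t) + (b - L) / 3 by linarith)
    have hle := hLS_le S hS0
    filter_upwards [hloc', htS, hf_int] with N hN htN hiN
    rw [hsplit S hS0 N hiN]
    linarith

/-! ### Chains with fewer than two sites carry no current -/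

theorem totalCurrent_eq_zero_of_lt_two (ω₂ lam β γ : ℝ) (N : ℕ) (hN : ¬ 2 ≤ N)
    (μ : MeasureTheory.Measure (PhaseSpace N)) :
    (pinnedChain ω₂ lam β γ).totalCurrent μ = 0 := by
  have hj : ∀ (i : Fin N) (x : PhaseSpace N), (pinnedChain ω₂ lam β γ).bondCurrent N i x = 0 :=
    fun i x => by
      unfold OscillatorChain.bondCurrent
      refine Finset.sum_eq_zero fun j _ => ?_
      have hji : ¬ (j.val = i.val + 1) := by have := j.isLt; have := i.isLt; omega
      rw [if_neg hji]
  unfold OscillatorChain.totalCurrent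
  exact Finset.sum_eq_zero fun i _ => by simp only [hj, MeasureTheory.integral_zero]

/-! ### The re-glued deciding theorem -/

/-- RE-GLUE.  `FouriersLaw` from K2 + (FSR) + (M) + (P): the majorant hypothesis (U)
`ContactUpperDensity` of `closes` is replaced by `FrictionSublinearResponse`.  Same skeleton as
`closes` (clause (i) from `pinnedChain_exists_isSteadyState` + `nessUnique_proof`; `D_N :=
(N-1)γ∫Φ_N w_γ`; positivity from (P)); the dominated-convergence step is replaced by
`tendsto_integral_of_tight`, whose tail tightness is read off (FSR) at ONE large friction `γ₀`
through the representation (`N∫_{(γ₀,∞)} Φ_N w_γ ≤ 4N∫ Φ_N w_{γ₀} = 4N·D_N(γ₀)/((N-1)γ₀)`). -/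
theorem closes_fsr (hRep : StieltjesRepresentation) (hF : FrictionSublinearResponse)
    (hLim : ContactMeasureLimit) (hP : ConductanceLowerBound) : _root_.FouriersLaw := by
  have hU : Summit.AtomisticToContinuum.FouriersLaw.Theses.EmbeddedDrudeMourre.NessUnique :=
    Summit.AtomisticToContinuum.FouriersLaw.Theorems.nessUnique_proof
  intro ω₂ lam β γ hω hl hβ hγ
  have huniq := hU ω₂ lam β γ hω hl hβ hγ
  have hex := fun (N : ℕ) (T_L T_R : ℝ) (hL : 0 < T_L) (hR : 0 < T_R) =>
    pinnedChain_exists_isSteadyState hω hl hβ hγ N hL hR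
  refine ⟨fun N T_L T_R hL hR => ?_, ?_⟩
  · obtain ⟨μ, hμ⟩ := hex N T_L T_R hL hR
    exact ⟨μ, hμ, fun ν hν => huniq N T_L T_R hL hR ν μ hν hμ⟩
  classical
  -- a steady-state family at every friction
  have hfam : ∀ γ' : ℝ, 0 < γ' →
      ∃ μ' : (N : ℕ) → ℝ → ℝ → MeasureTheory.Measure (PhaseSpace N),
        ∀ (N : ℕ) (T_L T_R : ℝ), 0 < T_L → 0 < T_R →
          (pinnedChain ω₂ lam β γ').IsSteadyState N T_L T_R (μ' N T_L T_R) := by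
    intro γ' hγ'
    have hex' := fun (N : ℕ) (T_L T_R : ℝ) (hL : 0 < T_L) (hR : 0 < T_R) =>
      pinnedChain_exists_isSteadyState hω hl hβ hγ' N hL hR
    refine ⟨fun N T_L T_R =>
      if h : 0 < T_L ∧ 0 < T_R then Classical.choose (hex' N T_L T_R h.1 h.2) else 0, ?_⟩
    intro N T_L T_R hL hR
    simp only [dif_pos (And.intro hL hR)]
    exact Classical.choose_spec (hex' N T_L T_R hL hR)
  obtain ⟨μ₀, hμ₀⟩ := hfam γ hγ
  have key : ∀ T : ℝ, 0 < T → ∃ κT : ℝ, 0 < κT ∧ ∃ D : ℕ → ℝ,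
      (∀ N : ℕ, Filter.Tendsto (fun δ : ℝ =>
        (pinnedChain ω₂ lam β γ).totalCurrent (μ₀ N (T + δ / 2) (T - δ / 2)) / δ)
          (nhdsWithin 0 {(0 : ℝ)}ᶜ) (nhds (D N))) ∧
      Filter.Tendsto D Filter.atTop (nhds κT) := by
    intro T hT
    obtain ⟨Φ, hΦ⟩ := hRep ω₂ lam β hω hl.le hβ.le T hT
    have hΦ_nonneg : ∀ N : ℕ, 2 ≤ N → ∀ t : ℝ, 0 ≤ t → 0 ≤ Φ N t := by
      intro N hN t ht
      have h0 : Φ N 0 = 0 := (hΦ N hN).2.1 0 le_rfl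
      simpa [h0] using (hΦ N hN).1 ht
    -- the response coefficient at friction γ' of ANY steady-state family, through the representation
    have hDgen : ∀ γ' : ℝ, 0 < γ' → ∀ μ' : (N : ℕ) → ℝ → ℝ → MeasureTheory.Measure (PhaseSpace N),
        (∀ (N : ℕ) (T_L T_R : ℝ), 0 < T_L → 0 < T_R →
          (pinnedChain ω₂ lam β γ').IsSteadyState N T_L T_R (μ' N T_L T_R)) →
        ∀ N : ℕ, Filter.Tendsto (fun δ : ℝ =>
            (pinnedChain ω₂ lam β γ').totalCurrent (μ' N (T + δ / 2) (T - δ / 2)) / δ)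
          (nhdsWithin 0 {(0 : ℝ)}ᶜ)
          (nhds (if 2 ≤ N then ((N : ℝ) - 1) * γ' *
            ∫ t in Ioi (0 : ℝ), Φ N t * (2 * t / (γ' ^ 2 + t ^ 2) ^ 2) else 0)) := by
      intro γ' hγ' μ' hμ' N
      by_cases hN : 2 ≤ N
      · rw [if_pos hN]
        exact (hΦ N hN).2.2.2 γ' hγ' (hU ω₂ lam β γ' hω hl hβ hγ') μ' hμ'
      · rw [if_neg hN]
        have e : (fun δ : ℝ =>
            (pinnedChain ω₂ lam β γ').totalCurrent (μ' N (T + δ / 2) (T - δ / 2)) / δ) =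
            fun _ => 0 := by
          funext δ
          rw [totalCurrent_eq_zero_of_lt_two ω₂ lam β γ' N hN, zero_div]
        rw [e]
        exact tendsto_const_nhds
    let D : ℕ → ℝ := fun N => if 2 ≤ N then
      ((N : ℝ) - 1) * γ * ∫ t in Ioi (0 : ℝ), Φ N t * (2 * t / (γ ^ 2 + t ^ 2) ^ 2) else 0
    have hDN : ∀ N : ℕ, 2 ≤ N →
        D N = ((N : ℝ) - 1) * γ * ∫ t in Ioi (0 : ℝ), Φ N t * (2 * t / (γ ^ 2 + t ^ 2) ^ 2) :=
      fun N hN => if_pos hN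
    have hD : ∀ N : ℕ, Filter.Tendsto (fun δ : ℝ =>
        (pinnedChain ω₂ lam β γ).totalCurrent (μ₀ N (T + δ / 2) (T - δ / 2)) / δ)
          (nhdsWithin 0 {(0 : ℝ)}ᶜ) (nhds (D N)) := hDgen γ hγ μ₀ hμ₀
    obtain ⟨M, hMmono, hM⟩ := hLim ω₂ lam β hω hl hβ T hT Φ hΦ
    set L : ℝ := ∫ t in Ioi (0 : ℝ), M t * (2 * t / (γ ^ 2 + t ^ 2) ^ 2) with hL
    -- hypotheses of `tendsto_integral_of_tight`
    have hf : ∀ᶠ N : ℕ in atTop, Measurable (fun t : ℝ => (N : ℝ) * Φ N t) ∧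
        (∀ t : ℝ, 0 ≤ t → 0 ≤ (N : ℝ) * Φ N t) ∧ Monotone (fun t : ℝ => (N : ℝ) * Φ N t) := by
      refine eventually_atTop.2 ⟨2, fun N hN => ⟨measurable_const.mul (hΦ N hN).1.measurable,
        fun t ht => mul_nonneg (Nat.cast_nonneg _) (hΦ_nonneg N hN t ht), fun a b hab => ?_⟩⟩
      exact mul_le_mul_of_nonneg_left ((hΦ N hN).1 hab) (Nat.cast_nonneg _)
    have hf_int : ∀ᶠ N : ℕ in atTop,
        IntegrableOn (fun t : ℝ => (N : ℝ) * Φ N t * (2 * t / (γ ^ 2 + t ^ 2) ^ 2)) (Ioi 0) := by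
      refine eventually_atTop.2 ⟨2, fun N hN => ?_⟩
      obtain ⟨m, hm⟩ := (hΦ N hN).2.2.1
      exact mul_w_integrableOn (Φ N) (hΦ N hN).1 (hΦ N hN).2.1 m hm (N : ℝ) γ hγ
    have hlim : ∀ᵐ t ∂(volume.restrict (Ioi (0 : ℝ))),
        Tendsto (fun N : ℕ => (N : ℝ) * Φ N t) atTop (𝓝 (M t)) := by
      have hS : volume {t : ℝ | ¬ContinuousAt M t} = 0 :=
        hMmono.countable_not_continuousAt.measure_zero _
      have hae : ∀ᵐ t ∂(volume.restrict (Ioi (0 : ℝ))), ContinuousAt M t := by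
        refine ae_restrict_of_ae ?_
        rw [ae_iff]
        simpa using hS
      filter_upwards [hae, ae_restrict_mem measurableSet_Ioi] with t hcont ht
      exact hM t ht hcont
    -- TAIL TIGHTNESS from (FSR) at one large friction γ₀
    have htail : ∀ ε : ℝ, 0 < ε → ∃ S : ℝ, 0 < S ∧ ∀ᶠ N : ℕ in atTop,
        ∫ t in Ioi S, (N : ℝ) * Φ N t * (2 * t / (γ ^ 2 + t ^ 2) ^ 2) ≤ ε := by
      intro ε hε
      obtain ⟨γ₀, hγ₀1, hF0⟩ := hF ω₂ lam β hω hl hβ T hT (ε / 8) (by positivity)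
      have hγ₀ : 0 < γ₀ := by linarith
      obtain ⟨μ₁, hμ₁⟩ := hfam γ₀ hγ₀
      obtain ⟨N₀, hN₀⟩ := hF0 (hU ω₂ lam β γ₀ hω hl hβ hγ₀) μ₁ hμ₁ _ (hDgen γ₀ hγ₀ μ₁ hμ₁)
      refine ⟨γ₀, hγ₀, eventually_atTop.2 ⟨max N₀ 2, fun N hN => ?_⟩⟩
      have hN2 : 2 ≤ N := le_trans (le_max_right _ _) hN
      have hb := hN₀ N (le_trans (le_max_left _ _) hN)
      rw [if_pos hN2] at hb
      set I₀ : ℝ := ∫ t in Ioi (0 : ℝ), Φ N t * (2 * t / (γ₀ ^ 2 + t ^ 2) ^ 2) with hI₀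
      have hN2' : (2 : ℝ) ≤ (N : ℝ) := by exact_mod_cast hN2
      have hI₀nn : 0 ≤ I₀ :=
        setIntegral_nonneg measurableSet_Ioi fun t ht =>
          mul_nonneg (hΦ_nonneg N hN2 t (le_of_lt ht)) (w_nonneg γ₀ t (le_of_lt ht))
      -- (N-1) I₀ ≤ ε/8
      have hI₀le : ((N : ℝ) - 1) * I₀ ≤ ε / 8 := by
        have h := hb
        nlinarith [h, hγ₀, hI₀nn]
      obtain ⟨m, hm⟩ := (hΦ N hN2).2.2.1
      have hint₀ : IntegrableOn
          (fun t : ℝ => (N : ℝ) * Φ N t * (2 * t / (γ₀ ^ 2 + t ^ 2) ^ 2)) (Ioi 0) :=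
        mul_w_integrableOn (Φ N) (hΦ N hN2).1 (hΦ N hN2).2.1 m hm (N : ℝ) γ₀ hγ₀
      have hint : IntegrableOn
          (fun t : ℝ => (N : ℝ) * Φ N t * (2 * t / (γ ^ 2 + t ^ 2) ^ 2)) (Ioi 0) :=
        mul_w_integrableOn (Φ N) (hΦ N hN2).1 (hΦ N hN2).2.1 m hm (N : ℝ) γ hγ
      have h1 : ∫ t in Ioi γ₀, (N : ℝ) * Φ N t * (2 * t / (γ ^ 2 + t ^ 2) ^ 2) ≤
          ∫ t in Ioi γ₀, 4 * ((N : ℝ) * Φ N t * (2 * t / (γ₀ ^ 2 + t ^ 2) ^ 2)) := by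
        refine setIntegral_mono_on (hint.mono_set (Ioi_subset_Ioi hγ₀.le))
          ((hint₀.mono_set (Ioi_subset_Ioi hγ₀.le)).const_mul 4) measurableSet_Ioi ?_
        intro t ht
        have ht' : γ₀ < t := ht
        have hnn : 0 ≤ (N : ℝ) * Φ N t :=
          mul_nonneg (Nat.cast_nonneg _) (hΦ_nonneg N hN2 t (by linarith))
        calc (N : ℝ) * Φ N t * (2 * t / (γ ^ 2 + t ^ 2) ^ 2)
            ≤ (N : ℝ) * Φ N t * (4 * (2 * t / (γ₀ ^ 2 + t ^ 2) ^ 2)) :=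
              mul_le_mul_of_nonneg_left (w_tail_le γ γ₀ t hγ hγ₀ ht'.le) hnn
          _ = 4 * ((N : ℝ) * Φ N t * (2 * t / (γ₀ ^ 2 + t ^ 2) ^ 2)) := by ring
      have h3 : ∫ t in Ioi γ₀, (N : ℝ) * Φ N t * (2 * t / (γ₀ ^ 2 + t ^ 2) ^ 2) ≤
          ∫ t in Ioi 0, (N : ℝ) * Φ N t * (2 * t / (γ₀ ^ 2 + t ^ 2) ^ 2) := by
        refine setIntegral_mono_set hint₀ ?_ (Ioi_subset_Ioi hγ₀.le).eventuallyLE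
        refine (ae_restrict_iff' measurableSet_Ioi).2 (Eventually.of_forall fun u hu => ?_)
        have hu0 : 0 < u := hu
        exact mul_nonneg (mul_nonneg (Nat.cast_nonneg _) (hΦ_nonneg N hN2 u hu0.le))
          (w_nonneg γ₀ u hu0.le)
      have h4 : ∫ t in Ioi 0, (N : ℝ) * Φ N t * (2 * t / (γ₀ ^ 2 + t ^ 2) ^ 2) = (N : ℝ) * I₀ := by
        rw [hI₀, ← integral_const_mul]
        congr 1
        funext t
        ring
      have h2 : ∫ t in Ioi γ₀, 4 * ((N : ℝ) * Φ N t * (2 * t / (γ₀ ^ 2 + t ^ 2) ^ 2)) ≤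
          4 * ((N : ℝ) * I₀) := by
        rw [integral_const_mul]
        exact mul_le_mul_of_nonneg_left (by linarith [h3, h4]) (by norm_num)
      -- N I₀ ≤ 2 (N-1) I₀ ≤ ε/4
      have h5 : (N : ℝ) * I₀ ≤ 2 * (((N : ℝ) - 1) * I₀) := by nlinarith [hI₀nn, hN2']
      linarith [h1, h2, h5, hI₀le]
    -- Vitali-type convergence
    obtain ⟨-, hDCT⟩ := tendsto_integral_of_tight (fun (N : ℕ) (t : ℝ) => (N : ℝ) * Φ N t) M
      (fun t : ℝ => 2 * t / (γ ^ 2 + t ^ 2) ^ 2) (w_continuous γ hγ) (fun t ht => w_pos γ t hγ ht)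
      (w_integrableOn γ hγ) hf hf_int hMmono.measurable hlim htail
    have hfrac : Filter.Tendsto (fun N : ℕ => ((N : ℝ) - 1) / N) Filter.atTop (nhds 1) := by
      have h : Filter.Tendsto (fun N : ℕ => (1 : ℝ) - 1 / (N : ℝ)) Filter.atTop (nhds (1 - 0)) :=
        tendsto_const_nhds.sub tendsto_one_div_atTop_nhds_zero_nat
      rw [sub_zero] at h
      refine h.congr' ?_
      filter_upwards [Filter.eventually_gt_atTop 0] with N hN
      have hN' : (N : ℝ) ≠ 0 := by exact_mod_cast hN.ne'
      field_simp
    have hDlim : Filter.Tendsto D Filter.atTop (nhds (γ * (1 * L))) := by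
      have h := (tendsto_const_nhds (x := γ)).mul (hfrac.mul hDCT)
      refine h.congr' ?_
      filter_upwards [Filter.eventually_ge_atTop 2] with N hN
      have hN' : (N : ℝ) ≠ 0 := by
        have : (2 : ℝ) ≤ N := by exact_mod_cast hN
        linarith
      rw [hDN N hN]
      have hfun : (fun t : ℝ => (N : ℝ) * Φ N t * (2 * t / (γ ^ 2 + t ^ 2) ^ 2)) =
          fun t : ℝ => (N : ℝ) * (Φ N t * (2 * t / (γ ^ 2 + t ^ 2) ^ 2)) := by
        funext t; ring
      show γ * ((↑N - 1) / ↑N * ∫ t in Ioi 0, (N : ℝ) * Φ N t * (2 * t / (γ ^ 2 + t ^ 2) ^ 2)) = _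
      rw [hfun, MeasureTheory.integral_const_mul]
      generalize (∫ t in Ioi (0 : ℝ), Φ N t * (2 * t / (γ ^ 2 + t ^ 2) ^ 2)) = I
      have hI : ((N : ℝ) - 1) / N * ((N : ℝ) * I) = ((N : ℝ) - 1) * I := by
        field_simp
      rw [hI]
      ring
    have hγL : γ * (1 * L) = γ * L := by ring
    rw [hγL] at hDlim
    obtain ⟨c, hc, N₁, hN₁⟩ := hP ω₂ lam β γ hω hl hβ hγ huniq μ₀ hμ₀ T hT D hD
    have hcL : c ≤ γ * L := ge_of_tendsto hDlim (Filter.eventually_atTop.2 ⟨N₁, hN₁⟩)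
    exact ⟨γ * L, lt_of_lt_of_le hc hcL, D, hD, hDlim⟩
  choose κf hκpos Df hDf hDlim using key
  refine ⟨fun T => if hT : 0 < T then κf T hT else 1, fun T hT => ?_, ?_⟩
  · simp only [dif_pos hT]; exact hκpos T hT
  intro μ hμ T hT
  refine ⟨Df T hT, fun N => ?_, ?_⟩
  · refine (hDf T hT N).congr' ?_
    have h2 : ∀ᶠ δ in nhds (0 : ℝ), δ < 2 * T := eventually_lt_nhds (by linarith)
    have h2' : ∀ᶠ δ in nhds (0 : ℝ), -(2 * T) < δ := eventually_gt_nhds (by linarith)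
    filter_upwards [mem_nhdsWithin_of_mem_nhds h2, mem_nhdsWithin_of_mem_nhds h2'] with δ hlt hgt
    have ha : 0 < T + δ / 2 := by linarith
    have hb : 0 < T - δ / 2 := by linarith
    rw [huniq N _ _ ha hb (μ₀ N _ _) (μ N _ _) (hμ₀ N _ _ ha hb) (hμ N _ _ ha hb)]
  · simp only [dif_pos hT]; exact hDlim T hT

/-! ### (U) ⟹ (FSR): the re-glue is a weakening of `closes` -/

/-- For `γ ≥ 1`, `(1+t)·w_γ(t) ≤ 3·(1+t²)⁻¹` on `t ≥ 0`. -/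
theorem one_add_mul_w_le (γ : ℝ) (hγ : 1 ≤ γ) (t : ℝ) (ht : 0 ≤ t) :
    (1 + t) * (2 * t / (γ ^ 2 + t ^ 2) ^ 2) ≤ 3 * (1 + t ^ 2)⁻¹ := by
  have h1t : 0 < 1 + t ^ 2 := by positivity
  have hγ2 : 1 ≤ γ ^ 2 := by nlinarith
  have hmono : 2 * t / (γ ^ 2 + t ^ 2) ^ 2 ≤ 2 * t / (1 + t ^ 2) ^ 2 := by
    refine div_le_div_of_nonneg_left (by linarith) (by positivity) ?_
    exact pow_le_pow_left₀ h1t.le (by linarith) 2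
  have hkey : (1 + t) * (2 * t / (1 + t ^ 2) ^ 2) ≤ 3 * (1 + t ^ 2)⁻¹ := by
    rw [mul_div_assoc', div_le_iff₀ (by positivity), mul_assoc, inv_mul_eq_div]
    have e : (1 + t ^ 2) ^ 2 / (1 + t ^ 2) = 1 + t ^ 2 := by
      rw [sq, mul_div_assoc, div_self h1t.ne', mul_one]
    rw [e]
    nlinarith [sq_nonneg (t - 1)]
  calc (1 + t) * (2 * t / (γ ^ 2 + t ^ 2) ^ 2) ≤ (1 + t) * (2 * t / (1 + t ^ 2) ^ 2) :=
        mul_le_mul_of_nonneg_left hmono (by linarith)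
    _ ≤ 3 * (1 + t ^ 2)⁻¹ := hkey

theorem one_add_mul_w_integrableOn (γ : ℝ) (hγ : 1 ≤ γ) :
    IntegrableOn (fun t : ℝ => (1 + t) * (2 * t / (γ ^ 2 + t ^ 2) ^ 2)) (Ioi 0) := by
  have hγ0 : 0 < γ := by linarith
  have hint : IntegrableOn (fun t : ℝ => 3 * (1 + t ^ 2)⁻¹) (Ioi 0) :=
    (integrable_inv_one_add_sq.const_mul _).integrableOn
  refine MeasureTheory.Integrable.mono' hint
    (Continuous.mul (by fun_prop) (w_continuous γ hγ0)).aestronglyMeasurable ?_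
  refine (ae_restrict_iff' measurableSet_Ioi).2 (Eventually.of_forall fun t ht => ?_)
  have ht' : 0 < t := ht
  rw [Real.norm_eq_abs, abs_of_nonneg (mul_nonneg (by linarith) (w_nonneg γ t ht'.le))]
  exact one_add_mul_w_le γ hγ t ht'.le

/-- `∫_{(0,∞)} (1+t) w_γ(t) dt → 0` as `γ → ∞` (dominated convergence, majorant `3(1+t²)⁻¹`). -/
theorem tendsto_integral_one_add_mul_w :
    Tendsto (fun γ : ℝ => ∫ t in Ioi (0 : ℝ), (1 + t) * (2 * t / (γ ^ 2 + t ^ 2) ^ 2))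
      atTop (𝓝 0) := by
  have h := tendsto_integral_filter_of_dominated_convergence
    (μ := volume.restrict (Ioi (0 : ℝ))) (l := atTop)
    (F := fun (γ : ℝ) (t : ℝ) => (1 + t) * (2 * t / (γ ^ 2 + t ^ 2) ^ 2)) (f := fun _ => (0 : ℝ))
    (fun t => 3 * (1 + t ^ 2)⁻¹) ?_ ?_ ?_ ?_
  · simpa using h
  · filter_upwards [eventually_ge_atTop (1 : ℝ)] with γ hγ
    exact (Continuous.mul (by fun_prop) (w_continuous γ (by linarith))).aestronglyMeasurable
  · filter_upwards [eventually_ge_atTop (1 : ℝ)] with γ hγ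
    refine (ae_restrict_iff' measurableSet_Ioi).2 (Eventually.of_forall fun t ht => ?_)
    have ht' : 0 < t := ht
    rw [Real.norm_eq_abs, abs_of_nonneg (mul_nonneg (by linarith) (w_nonneg γ t ht'.le))]
    exact one_add_mul_w_le γ hγ t ht'.le
  · exact (integrable_inv_one_add_sq.const_mul _).integrableOn
  · refine (ae_restrict_iff' measurableSet_Ioi).2 (Eventually.of_forall fun t ht => ?_)
    have ht' : 0 < t := ht
    have h1 : Tendsto (fun γ : ℝ => γ ^ 2 + t ^ 2) atTop atTop :=
      (tendsto_pow_atTop (by norm_num)).atTop_add tendsto_const_nhds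
    have h2 : Tendsto (fun γ : ℝ => (γ ^ 2 + t ^ 2) ^ 2) atTop atTop :=
      (tendsto_pow_atTop (by norm_num)).comp h1
    have h3 := (tendsto_const_nhds (x := (1 + t) * (2 * t))).div_atTop h2
    have e : (fun γ : ℝ => (1 + t) * (2 * t / (γ ^ 2 + t ^ 2) ^ 2)) =
        fun γ : ℝ => (1 + t) * (2 * t) / (γ ^ 2 + t ^ 2) ^ 2 := by
      funext γ
      ring
    rw [e]
    exact h3

/-- (U) ⟹ (FSR) given the representation K2: `D_N(γ) = (N-1)γ∫Φ_N w_γ ≤ γ·C·∫(1+t)w_γ`, and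
`∫(1+t)w_γ → 0` as `γ → ∞`.  Hence `closes_fsr` has strictly weaker hypotheses than `closes`. -/
theorem fsr_of_upperDensity (hRep : StieltjesRepresentation) (hUD : ContactUpperDensity) :
    FrictionSublinearResponse := by
  intro ω₂ lam β hω hl hβ T hT ε hε
  obtain ⟨Φ, hΦ⟩ := hRep ω₂ lam β hω hl.le hβ.le T hT
  obtain ⟨C, N₀, hC⟩ := hUD ω₂ lam β hω hl hβ T hT Φ hΦ
  have hΦ_nonneg : ∀ N : ℕ, 2 ≤ N → ∀ t : ℝ, 0 ≤ t → 0 ≤ Φ N t := by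
    intro N hN t ht
    have h0 : Φ N 0 = 0 := (hΦ N hN).2.1 0 le_rfl
    simpa [h0] using (hΦ N hN).1 ht
  have hC_nonneg : 0 ≤ C := by
    have h := hC (max N₀ 2) (le_max_left _ _) 1 one_pos
    have h' : 0 ≤ ((max N₀ 2 : ℕ) : ℝ) * Φ (max N₀ 2) 1 :=
      mul_nonneg (Nat.cast_nonneg _) (hΦ_nonneg _ (le_max_right _ _) 1 zero_le_one)
    linarith
  have hεC : 0 < ε / (C + 1) := by positivity
  have hev := (tendsto_order.1 tendsto_integral_one_add_mul_w).2 (ε / (C + 1)) hεC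
  obtain ⟨γ, hγI, hγ1⟩ := (hev.and (eventually_ge_atTop 1)).exists
  have hγ : 0 < γ := by linarith
  refine ⟨γ, hγ1, ?_⟩
  intro huniq μ hμ D hD
  refine ⟨max N₀ 2, fun N hN => ?_⟩
  have hN2 : 2 ≤ N := le_trans (le_max_right _ _) hN
  have hN0 : N₀ ≤ N := le_trans (le_max_left _ _) hN
  have hN2' : (2 : ℝ) ≤ (N : ℝ) := by exact_mod_cast hN2
  have hNpos : (0 : ℝ) < (N : ℝ) := by linarith
  have hDN : D N = ((N : ℝ) - 1) * γ *
      ∫ t in Ioi (0 : ℝ), Φ N t * (2 * t / (γ ^ 2 + t ^ 2) ^ 2) :=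
    tendsto_nhds_unique (hD N) ((hΦ N hN2).2.2.2 γ hγ huniq μ hμ)
  set Iw : ℝ := ∫ t in Ioi (0 : ℝ), (1 + t) * (2 * t / (γ ^ 2 + t ^ 2) ^ 2) with hIw
  set I : ℝ := ∫ t in Ioi (0 : ℝ), Φ N t * (2 * t / (γ ^ 2 + t ^ 2) ^ 2) with hI
  have hIw_nn : 0 ≤ Iw :=
    setIntegral_nonneg measurableSet_Ioi fun t ht => by
      have ht' : 0 < t := ht
      exact mul_nonneg (by linarith) (w_nonneg γ t ht'.le)
  have hIw_lt : Iw < ε / (C + 1) := hγI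
  obtain ⟨m, hm⟩ := (hΦ N hN2).2.2.1
  have hint1 : IntegrableOn (fun t : ℝ => Φ N t * (2 * t / (γ ^ 2 + t ^ 2) ^ 2)) (Ioi 0) := by
    simpa [one_mul] using mul_w_integrableOn (Φ N) (hΦ N hN2).1 (hΦ N hN2).2.1 m hm 1 γ hγ
  have hint2 : IntegrableOn
      (fun t : ℝ => C / N * ((1 + t) * (2 * t / (γ ^ 2 + t ^ 2) ^ 2))) (Ioi 0) :=
    (one_add_mul_w_integrableOn γ hγ1).const_mul _
  have hIle : I ≤ C / N * Iw := by
    rw [hI, hIw, ← integral_const_mul]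
    refine setIntegral_mono_on hint1 hint2 measurableSet_Ioi fun t ht => ?_
    have ht' : 0 < t := ht
    have hw := w_nonneg γ t ht'.le
    have hΦle : Φ N t ≤ C / N * (1 + t) := by
      rw [div_mul_eq_mul_div, le_div_iff₀ hNpos]
      have := hC N hN0 t ht'
      linarith
    calc Φ N t * (2 * t / (γ ^ 2 + t ^ 2) ^ 2)
        ≤ C / N * (1 + t) * (2 * t / (γ ^ 2 + t ^ 2) ^ 2) := mul_le_mul_of_nonneg_right hΦle hw
      _ = C / N * ((1 + t) * (2 * t / (γ ^ 2 + t ^ 2) ^ 2)) := by ring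
  have hCIw : C * Iw ≤ ε := by
    have h1 : Iw * (C + 1) ≤ ε := (le_div_iff₀ (by positivity)).1 hIw_lt.le
    nlinarith [hIw_nn, hC_nonneg]
  rw [hDN]
  have hfrac : ((N : ℝ) - 1) / N ≤ 1 := by
    rw [div_le_iff₀ hNpos]
    linarith
  have hstep : ((N : ℝ) - 1) * γ * I ≤ ((N : ℝ) - 1) * γ * (C / N * Iw) :=
    mul_le_mul_of_nonneg_left hIle (mul_nonneg (by linarith) hγ.le)
  have e : ((N : ℝ) - 1) * γ * (C / N * Iw) = (((N : ℝ) - 1) / N) * (γ * (C * Iw)) := by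
    field_simp
  rw [e] at hstep
  have h2 : (((N : ℝ) - 1) / N) * (γ * (C * Iw)) ≤ γ * (C * Iw) := by
    have hnn : 0 ≤ γ * (C * Iw) := mul_nonneg hγ.le (mul_nonneg hC_nonneg hIw_nn)
    nlinarith [hfrac, hnn]
  nlinarith [hstep, h2, hCIw, hγ]

end Summit.AtomisticToContinuum.FouriersLaw.Cruxes.ContactUpperDensity.Fsr
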